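import Literature.AlgebraicGeometry.Resolution.MinimalGeneratorsIndependent
import Literature.AlgebraicGeometry.Resolution.MarkedIdeals
import Literature.AlgebraicGeometry.Resolution.RegularLocalRingsProofs
import HarnessLib

/-!
# Boundary equations at an snc point are independent regular parameters

Topic: `Literature/AlgebraicGeometry/Resolution`. The glue between the simple normal crossings
condition `HasSNC E` (`MarkedIdeals.lean`: at every point a regular system of parameters `u`
adapted to the boundary components through it) and the cotangent-independence hypothesis
`∑ α_j x_j ∈ 𝔪² ⇒ α_j ∈ 𝔪` consumed by the local algebra of the endgame of the crux
`PicoverLocalModel` (`RegularParameterFamilies.lean` and its sequels): ANY family of generators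
`x_j` of the stalk ideals of distinct boundary components through the point (e.g. the one
provided by `InGiraudNormalForm`) consists of elements of `𝔪`, independent modulo `𝔪²`.

* `hli_of_span_singleton_eq` — algebra: `u : Fin d → O` spanning `𝔪` with `d ≤ μ(𝔪)` (Nakayama,
  `hli_of_span_eq_maximalIdeal`), `f : Fin r → Fin d` injective and `(x_j) = (u_{f j})` as ideals
  (so `x_j = ε_j u_{f j}` with units `ε_j` in the domain `O`) ⇒ `x_j ∈ 𝔪` and independence;
* `hli_of_hasSNC` — the scheme statement at a point `w` of `X` with `HasSNC E`.

Sources: [Matsumura1987] H. Matsumura, *Commutative Ring Theory*, Thm. 2.3, Thm. 14.2;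
[BierstoneGrigorievMilmanWlodarczyk2011] Def. 3.1.1 (snc divisors `E`). All statements PROVED.
-/

noncomputable section

namespace Literature.AlgebraicGeometry.Resolution

open IsLocalRing AlgebraicGeometry

/-- **Generators of the same principal ideals as members of a minimal system of parameters are
independent regular parameters.** [cite: Matsumura1987, Thm. 14.2] -/
theorem hli_of_span_singleton_eq {O : Type*} [CommRing O] [IsLocalRing O] [IsNoetherianRing O]
    [IsDomain O] {d : ℕ} (u : Fin d → O) (hspan : Ideal.span (Set.range u) = maximalIdeal O)
    (hd : d ≤ (maximalIdeal O).spanFinrank) {r : ℕ} (f : Fin r → Fin d)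
    (hf : Function.Injective f) (x : Fin r → O)
    (hx : ∀ j, Ideal.span {x j} = Ideal.span {u (f j)}) :
    (∀ j, x j ∈ maximalIdeal O) ∧
      ∀ α : Fin r → O, ∑ i, α i * x i ∈ maximalIdeal O ^ 2 → ∀ i, α i ∈ maximalIdeal O := by
  classical
  have hu : ∀ i, u i ∈ maximalIdeal O := fun i => hspan ▸ Ideal.subset_span ⟨i, rfl⟩
  -- `x_j = ε_j u_{f j}` with `ε_j` a unit
  have hassoc : ∀ j, Associated (u (f j)) (x j) := fun j =>
    Ideal.span_singleton_eq_span_singleton.mp (hx j).symm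
  choose ε hε using hassoc
  have hxε : ∀ j, x j = (ε j : O) * u (f j) := fun j => by rw [← hε j, mul_comm]
  refine ⟨fun j => by rw [hxε j]; exact Ideal.mul_mem_left _ _ (hu _), ?_⟩
  have hliu := hli_of_span_eq_maximalIdeal u hspan (by simpa using hd)
  have key := hli_comp_of_injective hliu f hf (fun j => (ε j : O)) (fun j => (ε j).isUnit)
  intro α hα
  refine key α ?_
  have : ∑ k, α k * ((ε k : O) * u (f k)) = ∑ i, α i * x i :=
    Finset.sum_congr rfl fun k _ => by rw [hxε k]
  rw [this]
  exact hα

/-- **At a point of a scheme with an snc boundary, any generators of the stalk ideals of distinct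
boundary components through the point are independent regular parameters in `𝔪`.**
[cite: BierstoneGrigorievMilmanWlodarczyk2011, Def. 3.1.1] -/
theorem hli_of_hasSNC {X : AlgebraicGeometry.Scheme} {E : List X.IdealSheafData} (hE : HasSNC E) (w : X) {r : ℕ}
    (D : Fin r → {D : X.IdealSheafData // D ∈ E ∧ w ∈ D.support}) (hD : Function.Injective D)
    (x : Fin r → X.presheaf.stalk w) (hx : ∀ j, stalkIdeal (D j).1 w = Ideal.span {x j}) :
    (∀ j, x j ∈ maximalIdeal (X.presheaf.stalk w)) ∧
      ∀ α : Fin r → X.presheaf.stalk w, ∑ i, α i * x i ∈ maximalIdeal (X.presheaf.stalk w) ^ 2 →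
        ∀ i, α i ∈ maximalIdeal (X.presheaf.stalk w) := by
  obtain ⟨hreg, u, hspan, ⟨ι, hι, hDι⟩, -⟩ := hE w
  haveI := hreg
  haveI := isDomain_of_isRegularLocalRing (X.presheaf.stalk w)
  refine hli_of_span_singleton_eq u hspan le_rfl (ι ∘ D) (hι.comp hD) x fun j => ?_
  rw [← hx j, Function.comp_apply, hDι (D j)]

end Literature.AlgebraicGeometry.Resolution

end
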